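import Summits.Parity.GeneralizedHardyLittlewood.Theorems.GreenTaoLevelTwoGITwoCyclicInverseTensorUniform
import Summits.Parity.GeneralizedHardyLittlewood.Theorems.GreenTaoLevelTwoGITwoCyclicInverseLinearMonomial
import Summits.Parity.GeneralizedHardyLittlewood.Theorems.GreenTaoLevelTwoGITwoCyclicInverseTensorExists

/-!
# Route `GreenTaoLevelTwo`, crux `GITwo` (stmt-Parity-21275), line `birth`, stub `stub_cyclicInverse`:
# uniform (nilmanifold-first) realisations: linear monomials on `𝕋²`, tensors over a finite index type

Seventy-eighth helper file toward the XL stub `stub_cyclicInverse` (B. Green, T. Tao, *An inverse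
theorem for the Gowers `U³(G)` norm*, arXiv:math/0503014, Thm. 68 = PEMS 51 (2008) Thm. 12.8).
Block E17, complements to `…TensorUniform` (the family of Thm. 68 must be fixed before `N`):

* `exists_bracket_linear_monomial_on` — arXiv Lemma 69 (linear-xi) on the explicit `𝕋 × 𝕋`
  (`(circle.ofLE).prod (circle.ofLE)`), for all `N` odd, `ξ`, `b` at once;
* `exists_character_on` — the character `e(n · valMinAbs ζ/N)` on the explicit circle;
* `exists_uniform_tensor` — Fintype-indexed form of `exists_uniform_tensor_family`: for a fixed
  family `X : ι → Nilmanifold 2` of class members, ONE class member `Z` on which every family of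
  `1`-bounded `Mᵢ`-Lipschitz `Φᵢ` (any `gᵢ, pᵢ`) is tensored, `Ψ(gⁿp) = ∏ᵢ Φᵢ(gᵢⁿpᵢ)`.

References: [GreenTao2008U3Inverse] arXiv:math/0503014, §12, Lemma 65, Lemma 69, Thm. 68.
-/

noncomputable section

namespace Summit.Parity.GeneralizedHardyLittlewood.GreenTaoLevelTwoGITwoCyclicInverse

open Literature.NumberTheory.Sieve
open Literature.NumberTheory.Sieve.GreenTaoLevelTwo

/-- **arXiv Lemma 69 (linear-xi) on the explicit torus `𝕋 × 𝕋`.** [cite: GreenTao2008U3Inverse, §12, Lemma 69] -/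
theorem exists_bracket_linear_monomial_on {κ : AddCircle (1 : ℝ) → ℝ} {r₂ Lκ : ℝ}
    (hr : r₂ < 1 / 2) (hκ : ∀ a, 0 ≤ κ a ∧ κ a ≤ 1) (hκ0 : ∀ a, r₂ ≤ ‖a‖ → κ a = 0)
    (hκL : ∀ a b, |κ a - κ b| ≤ Lκ * dist a b) (hLκ : 0 ≤ Lκ) {N : ℕ} [NeZero N] (hN : Odd N)
    (ξ : ZMod N) (b : ℝ) :
    let Z : Nilmanifold 2 := (Nilmanifold.circle.ofLE (by norm_num : 1 ≤ 2)).prod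
      (Nilmanifold.circle.ofLE (by norm_num : 1 ≤ 2))
    ∃ (Ψ : Z.G ⧸ Z.Γ → ℂ) (g : Z.G) (p : Z.G ⧸ Z.Γ),
      (∀ y, ‖Ψ y‖ ≤ 1) ∧
      (∀ y z, ‖Ψ y - Ψ z‖ ≤ ((Lκ + 2 * Real.pi + 2 / (1 / 2 - r₂)) + 2 * Real.pi) * Z.dist y z) ∧
      ∀ n : ℤ, Ψ (g ^ n • p) =
        (κ (ZMod.toAddCircle ((n : ZMod N) * ξ)) : ℂ) *
          ((AddCircle.toCircle (((b * ((((n : ZMod N) * ξ).valMinAbs : ℝ) / N) : ℝ)) :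
            AddCircle (1 : ℝ)) : Circle) : ℂ) := by
  intro Z
  obtain ⟨q, s, hbs, hs⟩ := exists_int_add_small b
  set α : ℝ := (ξ.valMinAbs : ℝ) / N with hα
  have hgap : 0 < 1 / 2 - r₂ := by linarith
  obtain ⟨Φ₁, g₁, p₁, hb₁, hL₁, horb₁⟩ := exists_linear_factor hr hκ hκ0 hκL hLκ ξ s
    (by norm_num : 1 ≤ 2)
  obtain ⟨Φ₂, g₂, p₂, hb₂, hL₂, horb₂⟩ := exists_circle_character (q * α) 0 (by norm_num : 1 ≤ 2)
  have hK₁ : 0 ≤ Lκ + 2 * Real.pi * |s| + 2 / (1 / 2 - r₂) := by positivity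
  obtain ⟨Ψ, g, p, hb, hLZ, horb⟩ := exists_tensor_pair_on_prod g₁ g₂ p₁ p₂ hK₁ Real.two_pi_pos.le
    hb₁ hb₂ hL₁ hL₂
  refine ⟨Ψ, g, p, hb, fun y z => (hLZ y z).trans ?_, fun n => ?_⟩
  · refine mul_le_mul_of_nonneg_right ?_ (Z.dist_nonneg y z)
    have : 2 * Real.pi * |s| ≤ 2 * Real.pi := by nlinarith [Real.pi_pos, abs_nonneg s]
    linarith
  · rw [horb n, horb₁ n, horb₂ n, mul_assoc]
    congr 1
    set m : ℝ := ((((n : ZMod N) * ξ).valMinAbs : ℝ)) / N with hm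
    have hmα : m = n * α - round ((n : ℝ) * α) := by
      have e : (n : ZMod N) * ξ = (((n * ξ.valMinAbs : ℤ)) : ZMod N) := by
        rw [Int.cast_mul, ZMod.coe_valMinAbs]
      rw [hm, e, valMinAbs_div_eq hN, hα]
      push_cast
      rw [show (n : ℝ) * (ξ.valMinAbs : ℝ) / N = n * ((ξ.valMinAbs : ℝ) / N) by ring]
    rw [← toCircle_coe_eq_exp, ← toCircle_coe_add_mul]
    have e1 : b * m = (s * m + (0 + n * (q * α))) + ((-(q * round ((n : ℝ) * α)) : ℤ) : ℝ) := by
      rw [hbs, hmα]; push_cast; ring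
    rw [e1, toCircle_coe_add_int]

/-- **Characters on the explicit circle**: `Φ(gⁿp) = toCircle(toAddCircle(n ζ))` with `Φ` `1`-bounded
and `2π`-Lipschitz. [cite: GreenTao2008U3Inverse, §12, Example 62] -/
theorem exists_character_on {N : ℕ} [NeZero N] (ζ : ZMod N) (h12 : 1 ≤ 2) :
    ∃ (Φ : (Nilmanifold.circle.ofLE h12).G ⧸ (Nilmanifold.circle.ofLE h12).Γ → ℂ)
      (g : (Nilmanifold.circle.ofLE h12).G)
      (p₀ : (Nilmanifold.circle.ofLE h12).G ⧸ (Nilmanifold.circle.ofLE h12).Γ),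
      (∀ y, ‖Φ y‖ ≤ 1) ∧
      (∀ y z, ‖Φ y - Φ z‖ ≤ (2 * Real.pi) * (Nilmanifold.circle.ofLE h12).dist y z) ∧
      ∀ n : ℤ, Φ (g ^ n • p₀) =
        ((AddCircle.toCircle (ZMod.toAddCircle ((n : ZMod N) * ζ)) : Circle) : ℂ) := by
  obtain ⟨Φ, g, p₀, hb, hL, horb⟩ := exists_circle_realisation
    (fun a => ((AddCircle.toCircle a : Circle) : ℂ)) (M := 2 * Real.pi)
    (fun a => by rw [Circle.norm_coe]) (fun a b => by
      rw [dist_eq_norm]; exact norm_toCircle_sub_toCircle_le a b) ((ζ.valMinAbs : ℝ) / N) 0 h12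
  refine ⟨Φ, g, p₀, hb, hL, fun n => ?_⟩
  rw [horb n, toAddCircle_intMul_eq]

/-- **Uniform tensor over a finite index type.**  For a fixed family `X : ι → Nilmanifold 2` of class
members there is ONE class member `Z` such that every family of `1`-bounded `Mᵢ`-Lipschitz `Φᵢ`
(any `gᵢ, pᵢ`) is tensored on `Z`: `Ψ(gⁿp) = ∏ᵢ Φᵢ(gᵢⁿpᵢ)`, Lipschitz `∑ᵢ Mᵢ`.
[cite: GreenTao2008U3Inverse, §12, Lemma 65] -/
theorem exists_uniform_tensor (H : Nilmanifold 2) {ι : Type*} [Fintype ι] [DecidableEq ι]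
    (X : ι → Nilmanifold 2) (hX : ∀ i, InHeisClass H (X i)) :
    ∃ Z : Nilmanifold 2, InHeisClass H Z ∧
      ∀ (Φ : ∀ i, (X i).G ⧸ (X i).Γ → ℂ) (g : ∀ i, (X i).G) (p : ∀ i, (X i).G ⧸ (X i).Γ)
        (M : ι → ℝ), (∀ i, 0 ≤ M i) → (∀ i y, ‖Φ i y‖ ≤ 1) →
        (∀ i y z, ‖Φ i y - Φ i z‖ ≤ M i * (X i).dist y z) →
        ∃ (Ψ : Z.G ⧸ Z.Γ → ℂ) (gZ : Z.G) (pZ : Z.G ⧸ Z.Γ),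
          (∀ y, ‖Ψ y‖ ≤ 1) ∧ (∀ y z, ‖Ψ y - Ψ z‖ ≤ (∑ i, M i) * Z.dist y z) ∧
          ∀ n : ℤ, Ψ (gZ ^ n • pZ) = ∏ i, Φ i (g i ^ n • p i) := by
  set e := Fintype.equivFin ι with he
  obtain ⟨Z, hZ, huniv⟩ := exists_uniform_tensor_family H (Fintype.card ι) (fun j => X (e.symm j))
    (fun j => hX _)
  refine ⟨Z, hZ, fun Φ g p M hM hb hL => ?_⟩
  obtain ⟨Ψ, gZ, pZ, hΨb, hΨL, horb⟩ := huniv (fun j => Φ (e.symm j)) (fun j => g (e.symm j))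
    (fun j => p (e.symm j)) (fun j => M (e.symm j)) (fun j => hM _) (fun j => hb _) (fun j => hL _)
  have hsum : ∑ j : Fin (Fintype.card ι), M (e.symm j) = ∑ i, M i :=
    Fintype.sum_equiv e.symm _ _ fun j => rfl
  refine ⟨Ψ, gZ, pZ, hΨb, fun y z => by rw [← hsum]; exact hΨL y z, fun n => ?_⟩
  rw [horb n]
  exact Fintype.prod_equiv e.symm _ _ fun j => rfl

end Summit.Parity.GeneralizedHardyLittlewood.GreenTaoLevelTwoGITwoCyclicInverse
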